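import Summits.QuantumAdvantage.AdviceFreeQNC0.WalkSupportLemma
import Mathlib.Tactic.ComputeDegree
import HarnessLib

/-!
# Cell qa-qnc0 (rung F-Q1, route RingFrame, crux α `RingToElim`): the FULL EXACT LAW as an exact
# threshold — a perfect full strategy of degree `D` on `m` bits exists iff `m ≤ 2D + 2`

Rounding off planner qa-qnc0-p1's TARGET §15.2 (= planner qa-qnc0-p2's Conjecture E4), all `D`,
all `m`: the lower half `fullSpan_not_perfect` (prover qn-prover-3 gen 5; `m = 2D+3`) extended to
every `m ≥ 2D+3` by restriction to fibres of the full module itself, and the upper half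
`fullSpan_perfect_of_le` (`WalkSupportLemma.lean`, `m ≤ 2D+2`):

* `chi_append` — a character of `{0,1}^{p+q}` factors over a split `u = w ++ b`
  (`Fin.prod_univ_add`); `nearPath_castAdd` — the left part of a pattern near the path is near the
  path; **`fullSpan_restrict`** — the restriction of `f ∈ M_D(P)` on `p + q` bits to a fibre
  `w ↦ f (w ++ b)` lies in `M_D(P)` on `p` bits (through the support lemma `fullSpan_eq_chiSpan`);
* `fullSpan_not_perfect_of_le` — no perfect `f ∈ M_D(P)` on any `m ≥ 2D+3` bits;
* **`fullSpan_perfect_iff`** — `(∃ f ∈ M_D(P), tr f ≡ 1) ↔ m ≤ 2D+2`;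
* `F4.exists_eq_add_mul_omega` (`𝔽₄ = 𝔽₂ ⊕ 𝔽₂ω`, by division with remainder in `𝔽₂[X]`),
  `F4.pow_four` (`x⁴ = x`), `F4.tr_sq`; **`exists_fullSpan_tr_eq_iff`** — THE CODE DESCRIPTION of
  TARGET §15.5 as ONE equivalence: `h = tr f` for some `f ∈ M_D(P)` iff `h² = h` and `L_a(h) = 0`
  at every pattern `a` with `a`, `ā` far from the path (`⊆`: `Lfun_tr_eq_zero_of_far`, gen 5;
  `⊇`: `exists_fullSpan_tr_eq`, `WalkSupportLemma.lean`).

The cell's theorem (planner qa-qnc0-p1 gen 3 statement, "threshold table n = 2..7 by GF(2)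
elimination"; prover qn-prover-3 gen 5/6 kernel proofs), 2026-08-27; not in print.  WHAT THIS IS
NOT: about FULL strategies (free `𝔽₄` coefficients); the ring/walk thresholds with `𝔽₂` selectors
(`⌊n/2⌋`, phase law) have only their lower halves in the kernel; no separation claim.
-/

noncomputable section

namespace Summit.QuantumAdvantage.AdviceFreeQNC0

open Finset Polynomial
open Literature.Computability.MetaComplexity Literature.Computability.MetaComplexity.Smolensky
open F4

variable {p q : ℕ}

/-! ### Restriction of the full module to a fibre -/

/-- **Characters factor over a split**: `χ_a(w ++ b) = χ_{a_L}(w) · χ_{a_R}(b)`. -/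
theorem chi_append (a : Fin (p + q) → Bool) (w : Fin p → Bool) (b : Fin q → Bool) :
    chi a (Fin.append w b) =
      chi (fun j => a (Fin.castAdd q j)) w * chi (fun j => a (Fin.natAdd p j)) b := by
  unfold chi
  rw [Fin.prod_univ_add]
  simp only [Fin.append_left, Fin.append_right]

/-- The path pattern restricted to the left part is a path pattern. -/
theorem aPat_castAdd (g : ℕ) (j : Fin p) : aPat (m := p + q) g (Fin.castAdd q j) = aPat (m := p) g j := by
  simp [aPat]

/-- **The left part of a near pattern is near**: `dist(a_L, a^{(g)}_L) ≤ dist(a, a^{(g)})`. -/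
theorem nearPath_castAdd {D : ℕ} {a : Fin (p + q) → Bool} (ha : NearPath D a) :
    NearPath D (fun j : Fin p => a (Fin.castAdd q j)) := by
  classical
  obtain ⟨g, hg⟩ := ha
  refine ⟨g, le_trans ?_ hg⟩
  unfold pdist
  refine Finset.card_le_card_of_injOn (fun j : Fin p => Fin.castAdd q j) (fun j hj => ?_)
    (fun j _ j' _ h => by simpa using h)
  have hj' := (Finset.mem_filter.1 (Finset.mem_coe.1 hj)).2
  refine Finset.mem_coe.2 (Finset.mem_filter.2 ⟨Finset.mem_univ _, ?_⟩)
  rw [aPat_castAdd]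
  exact hj'

/-- **Restriction to a fibre stays in the full module**: for `f ∈ M_D(P)` on `p + q` bits and any
`b ∈ {0,1}^q`, `w ↦ f(w ++ b)` lies in `M_D(P)` on `p` bits. -/
theorem fullSpan_restrict {D : ℕ} {f : (Fin (p + q) → Bool) → F4} (hf : f ∈ fullSpan (p + q) D)
    (b : Fin q → Bool) : (fun w : Fin p → Bool => f (Fin.append w b)) ∈ fullSpan p D := by
  rw [fullSpan_eq_chiSpan] at hf ⊢
  unfold chiSpan at hf
  induction hf using Submodule.span_induction with
  | mem g hg =>
    obtain ⟨a, ha, rfl⟩ := hg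
    have e : (fun w : Fin p → Bool => chi a (Fin.append w b)) =
        chi (fun j => a (Fin.natAdd p j)) b • chi (fun j => a (Fin.castAdd q j)) := by
      funext w
      rw [chi_append, Pi.smul_apply, smul_eq_mul, mul_comm]
    rw [e]
    exact Submodule.smul_mem _ _ (chi_mem_chiSpan (nearPath_castAdd ha))
  | zero =>
    have e : (fun w : Fin p → Bool => (0 : (Fin (p + q) → Bool) → F4) (Fin.append w b)) = 0 := by
      funext w; simp
    rw [e]; exact Submodule.zero_mem _
  | add g h _ _ hg hh =>
    have e : (fun w : Fin p → Bool => (g + h) (Fin.append w b)) =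
        (fun w => g (Fin.append w b)) + fun w => h (Fin.append w b) := by
      funext w; simp
    rw [e]; exact Submodule.add_mem _ hg hh
  | smul c g _ hg =>
    have e : (fun w : Fin p → Bool => (c • g) (Fin.append w b)) = c • fun w => g (Fin.append w b) := by
      funext w; simp
    rw [e]; exact Submodule.smul_mem _ _ hg

/-! ### The exact threshold -/

variable {m : ℕ}

/-- **No perfect full strategy of degree `D` on any `m ≥ 2D+3` bits.** -/
theorem fullSpan_not_perfect_of_le {D : ℕ} (hm : 2 * D + 3 ≤ m) {f : (Fin m → Bool) → F4}
    (hf : f ∈ fullSpan m D) : ∃ u, tr (f u) ≠ 1 := by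
  obtain ⟨q, rfl⟩ : ∃ q, m = 2 * D + 3 + q := ⟨m - (2 * D + 3), by omega⟩
  obtain ⟨w, hw⟩ := fullSpan_not_perfect D (fullSpan_restrict hf (fun _ => false))
  exact ⟨Fin.append w (fun _ => false), hw⟩

/-- **THE FULL EXACT LAW as an exact threshold** (TARGET §15.2 / E4, all `D`, all `m`): a perfect
full strategy of degree `D` on `m` bits exists iff `m ≤ 2D + 2`. [folklore] -/
theorem fullSpan_perfect_iff {D : ℕ} :
    (∃ f ∈ fullSpan m D, ∀ u, tr (f u) = 1) ↔ m ≤ 2 * D + 2 := by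
  constructor
  · rintro ⟨f, hf, hperf⟩
    by_contra h
    obtain ⟨u, hu⟩ := fullSpan_not_perfect_of_le (by omega) hf
    exact hu (hperf u)
  · exact fullSpan_perfect_of_le

/-! ### `𝔽₄ = 𝔽₂ ⊕ 𝔽₂·ω`, `x⁴ = x`, and the code description as one equivalence (TARGET §15.5) -/

/-- Every element of `𝔽₄` is `a + b·ω` with `a, b ∈ 𝔽₂`. -/
theorem F4.exists_eq_add_mul_omega (x : F4) :
    ∃ a b : ZMod 2, x = algebraMap (ZMod 2) F4 a + algebraMap (ZMod 2) F4 b * ω := by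
  induction x using AdjoinRoot.induction_on with
  | ih P =>
    have hmonic : (X ^ 2 + X + 1 : (ZMod 2)[X]).Monic := by monicity!
    set R := P %ₘ (X ^ 2 + X + 1 : (ZMod 2)[X]) with hR
    have hP : AdjoinRoot.mk (X ^ 2 + X + 1 : (ZMod 2)[X]) P = AdjoinRoot.mk (X ^ 2 + X + 1 : (ZMod 2)[X]) R := by
      conv_lhs => rw [← Polynomial.modByMonic_add_div P (X ^ 2 + X + 1 : (ZMod 2)[X])]
      rw [map_add, map_mul, AdjoinRoot.mk_self, zero_mul, add_zero]
    have hdeg : R.degree ≤ 1 := by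
      have h2 : (X ^ 2 + X + 1 : (ZMod 2)[X]).degree = 2 := by compute_degree!
      have hlt := Polynomial.degree_modByMonic_lt P hmonic
      rw [h2] at hlt
      rw [hR]
      exact Order.le_of_lt_succ hlt
    refine ⟨R.coeff 0, R.coeff 1, ?_⟩
    rw [hP]
    conv_lhs => rw [Polynomial.eq_X_add_C_of_degree_le_one hdeg]
    rw [map_add, map_mul, AdjoinRoot.mk_C, AdjoinRoot.mk_C, AdjoinRoot.mk_X, AdjoinRoot.algebraMap_eq]
    unfold ω
    ring

/-- **`x⁴ = x` in `𝔽₄`.** -/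
theorem F4.pow_four (x : F4) : x ^ 4 = x := by
  obtain ⟨a, b, rfl⟩ := F4.exists_eq_add_mul_omega x
  have ha : a ^ 2 = a := by fin_cases a <;> rfl
  have hb : b ^ 2 = b := by fin_cases b <;> rfl
  have hsq : ∀ y z : F4, (y + z) ^ 2 = y ^ 2 + z ^ 2 := add_sq'
  rw [show (4 : ℕ) = 2 * 2 from rfl, pow_mul, hsq, mul_pow, ← map_pow, ← map_pow, ha, hb, hsq, mul_pow,
    ← map_pow, ← map_pow, ha, hb, ← pow_mul, omega_pow_mod (2 * 2), show 2 * 2 % 3 = 1 from rfl, pow_one]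

/-- `tr x ∈ 𝔽₂`: `(tr x)² = tr x`. -/
theorem F4.tr_sq (x : F4) : tr x ^ 2 = tr x := by
  unfold tr
  rw [add_sq', ← pow_mul, show 2 * 2 = 4 from rfl, F4.pow_four, add_comm]

/-- **THE CODE DESCRIPTION** (TARGET §15.5, both inclusions): `h` is the win pattern `tr f` of
some full strategy `f ∈ M_D(P)` iff `h` takes values in `𝔽₂` (`h² = h`) and its coefficients
`L_a(h)` vanish at every pattern `a` with `a` and `ā` farther than `D` from the path. [folklore] -/
theorem exists_fullSpan_tr_eq_iff {D : ℕ} (h : (Fin m → Bool) → F4) :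
    (∃ f ∈ fullSpan m D, ∀ u, tr (f u) = h u) ↔
      (∀ u, h u ^ 2 = h u) ∧
        ∀ a : Fin m → Bool, ¬ NearPath D a → ¬ NearPath D (conj a) → Lfun a h = 0 := by
  constructor
  · rintro ⟨f, hf, htr⟩
    have hfun : (fun u => tr (f u)) = h := funext htr
    refine ⟨fun u => ?_, fun a ha ha' => ?_⟩
    · rw [← htr u]
      exact F4.tr_sq (f u)
    · rw [← hfun]
      exact Lfun_tr_eq_zero_of_far hf ha ha'
  · rintro ⟨hh, hfar⟩
    exact exists_fullSpan_tr_eq h hh hfar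

end Summit.QuantumAdvantage.AdviceFreeQNC0

end
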